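import Literature.Computability.QuantumComplexity.ChainCompose
import Literature.Computability.Complexity.GenProgramsTwo
import HarnessLib

/-!
# Iterated composition of a uniform quantum circuit family along a chain of stages, II: uniformity and `hLoop`

Topic `Literature/Computability/QuantumComplexity`; sequel of `ChainCompose.lean` (the chain family
`ChainCompose.family P` — stage blocks side by side, the input of block `k` assembled from the input
wires and the window of block `k - 1`, swap–copy–swap, the last block swapped to the front — and its
exact output law `map_take_kernel` / `chainLaw_toOuterMeasure_le`). This file proves that the chain
family is **polynomial-time uniform** (`family_isUniform`) and packages hypothesis `hLoop` of
`Literature.Computability.Cryptography.Regev2009.thm_3_1_machine_of_stages`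
(`Cryptography/RegevMainTheoremStages.lean`; Regev 2009, Thm 3.1, the loop of the printed proof) in the
generic form of `StageChains.chainLaw`: **`ChainCompose.exists_chainFamily`** — for every poly-time
uniform oracle-free Clifford+T family `S` and polynomials `T`, `m` there is a uniform family `D` with
`(chainLaw 0 S.family (m |x|) x (T |x|))(E) ≤ Pr[some y ∈ E is a prefix of D's measured register on x]`
for all `x`, `E` (Bernstein–Vazirani 1997, §8.2: classical control and subroutine calls inside quantum
machines; Nielsen–Chuang 2010, §4.4: deferred measurement).

Uniformity follows the pattern of `PolyCopies.lean`, Part IV (Arora–Barak 2009, §6.2 and Remark 6.7: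
descriptions printed with counters): by `QCircuitFamily.isUniform_of_descFn_mem_FP` it suffices that
`1ⁿ ↦ ⟨bin n, ⟨1^{anc n}, encode (circ n)⟩⟩` is in `FP`, and `encode (circ n)` is, stage by stage, the
program `prep n k` — printed by a generator program with TWO counters `n` and `k`
(`GStmt.render_out₂_mem_FP` of `Complexity/GenProgramsTwo.lean`; `genPrep`, `out_genPrep`) — the swap of
the front window with block `k` (`SwapDesc.swapDescFn` at the binary offset `blk n k 0`), the description
of `S.circ (ℓ n k)` verbatim (the body of `S.descFn ∈ FP` at `1^{ℓ n k}`), the swap again, and finally the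
tail swap; stage `0` (no window), the stages `k + 1` (`k < T n - 1`) and the tail are three counted
concatenation folds (`FoldBricks.foldLoop`) with a common ruler bounding the pieces (`descBody_apply`).
Everything is PROVED; no named fact is introduced.

## References

* E. Bernstein, U. Vazirani, *Quantum complexity theory*, SIAM J. Comput. 26 (1997) 1411–1473, §8.2
  [BernsteinVazirani1997].
* M. A. Nielsen, I. L. Chuang, *Quantum Computation and Quantum Information*, CUP 2010, §4.4
  (principle of deferred measurement) [NielsenChuang2010].
* S. Arora, B. Barak, *Computational Complexity: A Modern Approach*, CUP 2009, §1.3 (bounded loops),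
  §6.1–6.2, Def. 6.12, Remark 6.7 (uniformly generated circuits) [AroraBarak2009].
* O. Regev, *On lattices, learning with errors, random linear codes, and cryptography*, J. ACM 56
  (2009), art. 34, Thm 3.1 (proof, p. 15 of arXiv:2401.03703: the loop) [Regev2009].
-/

noncomputable section

namespace Literature.Computability.QuantumComplexity

namespace ChainCompose

open _root_.Computability Complexity Cryptography RevSim RevMux Function Matrix Finset

variable (P : Params)

variable {P} in
/-- The last block index is a block index (at a length). [folklore] -/
theorem pred_lt' {n : ℕ} (hT : 0 < T P n) : T P n - 1 < T P n := Nat.sub_lt hT Nat.one_pos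

/-! ## Part V. The chain family is uniform

By `QCircuitFamily.isUniform_of_descFn_mem_FP` it suffices that the description
`1ⁿ ↦ ⟨bin n, ⟨1^{anc n}, encode (circ n)⟩⟩` is in `FP`. `encode (circ n)` is the concatenation of the
description bits of the stages — for each `k < T n`: the program `prep n k` (printed by a generator
program with TWO counters `n`, `k`, `GStmt.render_out₂_mem_FP`), the swap of the front window with
block `k` (`SwapDesc.swapDescFn` at the binary offset `base n + k · B n`), the description of
`S.circ (ℓ n k)` verbatim (the body of `S.descFn ∈ FP` at `1^{ℓ n k}`), the swap again — followed by the
tail swap. Stage `0` (no window) and the stages `k + 1`, `k < T n - 1` are folded separately by the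
counted concatenation fold of `FoldBricks.lean` with a ruler bounding the pieces (the pattern of
`PolyCopies.lean`, Part IV; Arora–Barak 2009, §6.2 and Remark 6.7: descriptions printed with counters),
with `min (T n) 1` resp. `T n - 1` rounds. -/

section Uniform

open Polynomial Complexity.Brick Plumb RevDesc RevClean Complexity.GExpr

/-! ### Stage descriptions are program descriptions -/

section Desc

variable {P}

/-- The description bits of a clamped compiled program are the `opBits` of the program.
[cite: AroraBarak2009, §6.1 (descriptions of circuits)] -/
theorem flatMap_gateEnc_clamp (n : ℕ) (ops : List (ClOp ℕ)) (hlt : ∀ op ∈ ops, ∀ i ∈ wiresOf op, i < n + anc P n)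
    (hwf : ∀ op ∈ ops, op.WF) :
    (revCompile (clamp P n ops hlt hwf)).flatMap gateEnc = ops.flatMap opBits :=
  flatMap_gateEnc_revCompile_toRevList (width_pos n) ops hlt _

/-- The input assembly describes as `prep` (for `k < T n`). [folklore] -/
theorem flatMap_gateEnc_prepGates {n k : ℕ} (hk : k < T P n) :
    (prepGates P n k).flatMap gateEnc = (prep P n k).flatMap opBits := by
  unfold prepGates; rw [dif_pos hk]; exact flatMap_gateEnc_clamp n _ _ _

/-- The conjugating swap describes as `progConj` (for `k < T n`). [folklore] -/
theorem flatMap_gateEnc_conjGates {n k : ℕ} (hk : k < T P n) :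
    (conjGates P n k).flatMap gateEnc = (progConj P n k).flatMap opBits := by
  unfold conjGates; rw [dif_pos hk]; exact flatMap_gateEnc_clamp n _ _ _

/-- The copy describes as the given circuit, verbatim (for `k < T n`). [cite: AroraBarak2009, §6.2 (a circuit for each input length, hard-wired)] -/
theorem flatMap_gateEnc_copyGates {n k : ℕ} (hk : k < T P n) :
    (copyGates P n k).flatMap gateEnc = (P.S.family.circ (ℓ P n k)).encode := by
  unfold copyGates
  rw [dif_pos hk, show (P.S.family.circ (ℓ P n k)).encode = QCircuit.encode (⟨(P.S.family.circ (ℓ P n k)).gates⟩ : QCircuit cliffordT _)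
    from rfl, encode_eq_flatMap]
  simp only [mapWires, List.flatMap_map]
  congr 1
  funext g
  exact CWrap.gateEnc_mapWiresGate_castLEEmb _ g

/-- **The description of stage `k`.** [folklore] -/
theorem flatMap_gateEnc_stageGates {n k : ℕ} (hk : k < T P n) :
    (stageGates P n k).flatMap gateEnc = (prep P n k).flatMap opBits ++ ((progConj P n k).flatMap opBits ++
      ((P.S.family.circ (ℓ P n k)).encode ++ (progConj P n k).flatMap opBits)) := by
  rw [stageGates, List.flatMap_append, List.flatMap_append, List.flatMap_append, flatMap_gateEnc_prepGates hk,
    flatMap_gateEnc_conjGates hk, flatMap_gateEnc_copyGates hk]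

/-- The description of the swap of block `k`, as printed by `swapDescFn`. [folklore] -/
theorem swapDescFn_blk (n k : ℕ) :
    SwapDesc.swapDescFn (boolPair (encodeNat (blk P n k 0)) (ones (B P n))) = (progConj P n k).flatMap opBits := by
  rw [SwapDesc.swapDescFn_apply]; rfl

end Desc

/-! ### The layout as counter expressions and as polynomials -/

/-- The window `m` as an expression in the input length `uu`. [folklore] -/
def mE : GE := CWrap.polyE P.pm (.var .uu)

/-- The number of stages `T` as an expression. [folklore] -/
def TE : GE := CWrap.polyE P.pT (.var .uu)

/-- The bound `ℓmax` as an expression. [folklore] -/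
def ℓmaxE : GE := .add (.add (.add (.mul (.const 2) (.var .uu)) (.mul (.const 2) (TE P))) (.const 4)) (mE P)

/-- The block width `B` as an expression. [folklore] -/
def BE : GE := .add (.add (.add (mE P) (ℓmaxE P)) (CWrap.polyE P.pS (ℓmaxE P))) (.const 2)

/-- The first block wire `base` as an expression. [folklore] -/
def baseE : GE := .add (BE P) (.const 1)

/-- Wire `i` of block `j` as an expression transformer. [folklore] -/
def blkE (jE iE : GE) : GE := .add (.add (baseE P) (.mul jE (BE P))) iE

/-- `ℓmax(n)` as a polynomial. [folklore] -/
def ℓmaxPoly : Polynomial ℕ := C 2 * X + C 2 * P.pT + C 4 + P.pm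

/-- `B(n)` as a polynomial. [folklore] -/
def BPoly : Polynomial ℕ := P.pm + ℓmaxPoly P + P.pS.comp (ℓmaxPoly P) + C 2

/-- `base(n)` as a polynomial. [folklore] -/
def basePoly : Polynomial ℕ := BPoly P + 1

/-- `W(n)` as a polynomial. [folklore] -/
def WPoly : Polynomial ℕ := basePoly P + P.pT * BPoly P

variable {P}

/-- Value of `mE`. [folklore] -/
@[simp] theorem eval_mE (env : GV → ℕ) : (mE P).eval env = m P (env .uu) := by simp [mE, m, GExpr.eval]

/-- Value of `TE`. [folklore] -/
@[simp] theorem eval_TE (env : GV → ℕ) : (TE P).eval env = T P (env .uu) := by simp [TE, T, GExpr.eval]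

/-- Value of `ℓmaxE`. [folklore] -/
@[simp] theorem eval_ℓmaxE (env : GV → ℕ) : (ℓmaxE P).eval env = ℓmax P (env .uu) := by simp [ℓmaxE, GExpr.eval, ℓmax]

/-- Value of `BE`. [folklore] -/
@[simp] theorem eval_BE (env : GV → ℕ) : (BE P).eval env = B P (env .uu) := by simp [BE, GExpr.eval, B]

/-- Value of `baseE`. [folklore] -/
@[simp] theorem eval_baseE (env : GV → ℕ) : (baseE P).eval env = base P (env .uu) := by simp [baseE, GExpr.eval, base]

/-- Value of `blkE`. [folklore] -/
@[simp] theorem eval_blkE (jE iE : GE) (env : GV → ℕ) : (blkE P jE iE).eval env = blk P (env .uu) (jE.eval env) (iE.eval env) := by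
  simp [blkE, GExpr.eval, blk]

/-- Value of `ℓmaxPoly`. [folklore] -/
@[simp] theorem eval_ℓmaxPoly (n : ℕ) : (ℓmaxPoly P).eval n = ℓmax P n := by simp [ℓmaxPoly, ℓmax, T, m]

/-- Value of `BPoly`. [folklore] -/
@[simp] theorem eval_BPoly (n : ℕ) : (BPoly P).eval n = B P n := by simp [BPoly, B, m, Polynomial.eval_comp]

/-- Value of `basePoly`. [folklore] -/
@[simp] theorem eval_basePoly (n : ℕ) : (basePoly P).eval n = base P n := by simp [basePoly, base]

/-- Value of `WPoly`. [folklore] -/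
@[simp] theorem eval_WPoly (n : ℕ) : (WPoly P).eval n = W P n := by simp [WPoly, W, T]

/-! ### The input assembly: generator programs -/

variable (P)

/-- Twice an expression. [folklore] -/
def twiceE (e : GE) : GE := .mul (.const 2) e

/-- **Generator of `prep n k`** for the stage `k = kE` writing block `kE` from the input wires and the
window of block `pE` (the previous block), the window loop having bound `wE`:
`for t < n: CNOT t (blk k 2t)`; `for t < n: CNOT t (blk k (2t+1))`; `NOT (blk k (2n+1))`;
`for t < 2k: NOT (blk k (2n+2+t))`; `NOT (blk k (2n+2k+3))`; `for t < w: CNOT (blk p t) (blk k (2n+2k+4+t))`.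
[cite: AroraBarak2009, §6.2 (descriptions printed with counters)] -/
def genPrep (kE pE wE : GE) : GS :=
  seqs [GStmt.loop .tt (.var .uu) (opsG [ClOp.cnot (.var .tt) (blkE P kE (twiceE (.var .tt)))]),
    GStmt.loop .tt (.var .uu) (opsG [ClOp.cnot (.var .tt) (blkE P kE (.add (twiceE (.var .tt)) (.const 1)))]),
    opsG [ClOp.not (blkE P kE (.add (twiceE (.var .uu)) (.const 1)))],
    GStmt.loop .tt (twiceE kE) (opsG [ClOp.not (blkE P kE (.add (.add (twiceE (.var .uu)) (.const 2)) (.var .tt)))]),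
    opsG [ClOp.not (blkE P kE (.add (.add (twiceE (.var .uu)) (twiceE kE)) (.const 3)))],
    GStmt.loop .tt wE (opsG [ClOp.cnot (blkE P pE (.var .tt))
      (blkE P kE (.add (.add (.add (twiceE (.var .uu)) (twiceE kE)) (.const 4)) (.var .tt)))])]

/-- **Generator of stage `0`** (one counter: `uu = n`; no window). [cite: AroraBarak2009, §6.2 (descriptions printed with counters)] -/
def gen0 : GS := genPrep P (.const 0) (.const 0) (.const 0)

/-- **Generator of stage `xn + 1`** (two counters: `uu = n`, `xn = k - 1`; window `m n` read off block
`xn`). [cite: AroraBarak2009, §6.2 (descriptions printed with counters)] -/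
def genS : GS := genPrep P (.add (.var .xn) (.const 1)) (.var .xn) (mE P)

variable {P}

/-- Updating the loop counter `tt` keeps `uu`. [folklore] -/
theorem update_tt_uu (env : GV → ℕ) (a : ℕ) : Function.update env GV.tt a GV.uu = env GV.uu :=
  Function.update_of_ne (by decide) _ _

/-- Updating the loop counter `tt` keeps `xn`. [folklore] -/
theorem update_tt_xn (env : GV → ℕ) (a : ℕ) : Function.update env GV.tt a GV.xn = env GV.xn :=
  Function.update_of_ne (by decide) _ _

/-- **The generator prints `prep`**, for values of the block expressions that do not depend on the loop
counter. [folklore] -/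
theorem out_genPrep (kE pE wE : GE) (env : GV → ℕ) (k p w : ℕ)
    (hk : ∀ a, kE.eval (Function.update env GV.tt a) = k) (hk' : kE.eval env = k)
    (hp : ∀ a, pE.eval (Function.update env GV.tt a) = p) (hw : wE.eval env = w) (hwyl : w = yl P (env .uu) k)
    (hpk : p = k - 1) :
    (genPrep P kE pE wE).out env = (prep P (env .uu) k).flatMap opToks := by
  subst hwyl hpk
  simp only [genPrep, out_seqs, GStmt.out, out_opsG, List.map_cons, List.map_nil, ClOp.map, GExpr.eval, twiceE,
    Function.update_self, update_tt_uu, eval_blkE, hk, hk', hp, hw, List.flatMap_cons, List.flatMap_nil, List.append_nil,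
    prep, List.flatMap_append, List.flatMap_map, yoff]

/-- The stage-0 generator prints `prep n 0`. [folklore] -/
theorem out_gen0 (env : GV → ℕ) : (gen0 P).out env = (prep P (env .uu) 0).flatMap opToks :=
  out_genPrep _ _ _ env 0 0 0 (fun _ => rfl) rfl (fun _ => rfl) rfl (by simp) rfl

/-- The stage-`xn + 1` generator prints `prep n (xn + 1)`. [folklore] -/
theorem out_genS (env : GV → ℕ) : (genS P).out env = (prep P (env .uu) (env .xn + 1)).flatMap opToks :=
  out_genPrep _ _ _ env (env .xn + 1) (env .xn) (m P (env .uu))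
    (fun a => by simp [GExpr.eval]) (by simp [GExpr.eval]) (fun a => by simp [GExpr.eval])
    (eval_mE env) (by simp) (by simp)

/-- The loop variables of the generator are `tt` and tick counters. [folklore] -/
theorem lv_genPrep (kE pE wE : GE) : LV (fun v => v = GV.tt ∨ v = GV.ii) (genPrep P kE pE wE) := by
  refine lv_seqs fun s hs => ?_
  simp only [List.mem_cons, List.not_mem_nil, or_false] at hs
  rcases hs with rfl | rfl | rfl | rfl | rfl | rfl <;>
    first
      | exact lv_loop (Or.inl rfl) (lv_opsG (Or.inr rfl) _)
      | exact lv_opsG (Or.inr rfl) _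

/-- The generator does not reuse loop variables. [folklore] -/
theorem noReuse_genPrep (kE pE wE : GE) : (genPrep P kE pE wE).noReuse = true := by
  refine noReuse_seqs _ fun s hs => ?_
  simp only [List.mem_cons, List.not_mem_nil, or_false] at hs
  rcases hs with rfl | rfl | rfl | rfl | rfl | rfl <;>
    first
      | exact noReuse_loop_of (lv_opsG (by decide) _) (noReuse_opsG _)
      | exact noReuse_opsG _

/-- `uu` is not a loop variable of the generator. [folklore] -/
theorem uu_notMem_loopVars_genPrep (kE pE wE : GE) : GV.uu ∉ (genPrep P kE pE wE).loopVars := fun h => by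
  rcases lv_genPrep kE pE wE _ h with h | h <;> exact absurd h (by decide)

/-- `xn` is not a loop variable of the generator. [folklore] -/
theorem xn_notMem_loopVars_genPrep (kE pE wE : GE) : GV.xn ∉ (genPrep P kE pE wE).loopVars := fun h => by
  rcases lv_genPrep kE pE wE _ h with h | h <;> exact absurd h (by decide)

variable (P)

/-- **The description of `prep n 0` as a string function of `1ⁿ`** (any string of length `n`). [folklore] -/
def prep0F : List Bool → List Bool := fun z => Tok.render 0 ((gen0 P).out (GenProg.initEnv GV.uu z.length))

/-- **The description of `prep n (k + 1)` as a string function of `1ⁿ 0 w`, `|w| = k`.** [folklore] -/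
def prepSF : List Bool → List Bool := fun z => Tok.render 0 ((genS P).out (GenProg.parseEnv GV.uu GV.xn (fun _ => 0) z))

variable {P}

/-- `prep0F ∈ FP`. [cite: AroraBarak2009, §6.2 Def. 6.12 and Remark 6.7 (descriptions printed in polynomial time)] -/
theorem prep0F_mem_FP : prep0F P ∈ FP :=
  GStmt.render_out_mem_FP (gen0 P) GV.uu (uu_notMem_loopVars_genPrep _ _ _) (noReuse_genPrep _ _ _)

/-- `prepSF ∈ FP`. [cite: AroraBarak2009, §6.2 Def. 6.12 and Remark 6.7 (descriptions printed in polynomial time)] -/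
theorem prepSF_mem_FP : prepSF P ∈ FP :=
  GStmt.render_out₂_mem_FP (genS P) GV.uu GV.xn (uu_notMem_loopVars_genPrep _ _ _) (xn_notMem_loopVars_genPrep _ _ _)
    (noReuse_genPrep _ _ _)

/-- Value of `prep0F`. [folklore] -/
theorem prep0F_apply (z : List Bool) : prep0F P z = (prep P z.length 0).flatMap opBits := by
  rw [prep0F, out_gen0, RevClean.render_flatMap_opToks_nil, GenProg.initEnv_self]

/-- Value of `prepSF` on `1ⁿ 0 1ᵏ`. [folklore] -/
theorem prepSF_apply (n k : ℕ) : prepSF P (ones n ++ false :: ones k) = (prep P n (k + 1)).flatMap opBits := by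
  rw [prepSF, ones, GenProg.parseEnv_replicate (show GV.uu ≠ GV.xn by decide), out_genS, RevClean.render_flatMap_opToks_nil]
  simp [GenProg.initEnv₂, ones]

/-! ### The pieces of the folds -/

section Pieces

variable (P)

/-- The context field of a piece: `z` (as `⟨⟨z, ruler⟩, 1ʲ⟩ ↦ z`). [folklore] -/
def zOf : List Bool → List Bool := fstF ∘ fstF

/-- The swap of block `offPoly(n) / B(n)`-th kind: `swapDescFn ⟨bin (offPoly n + j · B n · [useIdx]), 1^{B n}⟩` —
concretely, the swap piece with binary offset `off n + j · B n` where `off = offPoly` and the round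
index `j` is used (`swJF`) or with a fixed offset (`swCF`). [folklore] -/
def swJF (offPoly : Polynomial ℕ) : List Bool → List Bool :=
  SwapDesc.swapDescFn ∘ fanoutFn
    (addFn ∘ fanoutFn (lenBinF ∘ polyFn offPoly ∘ zOf) (prodFn ∘ fanoutFn (lenBinF ∘ sndF) (lenBinF ∘ polyFn (BPoly P) ∘ zOf)))
    (polyFn (BPoly P) ∘ zOf)

/-- The copy piece of the stage whose input length is `aPoly(n) + 2j`: the body of `S.descFn` at that
unary length. [folklore] -/
def copyJF (aPoly : Polynomial ℕ) : List Bool → List Bool :=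
  sndF ∘ sndF ∘ P.S.family.descFn ∘ appF ∘ fanoutFn (polyFn aPoly ∘ zOf) (polyFn (C 2 * X) ∘ sndF)

/-- The input-assembly piece of stage `j + 1`: `prepSF` on `1ⁿ 0 1ʲ`. [folklore] -/
def prepJF : List Bool → List Bool := prepSF P ∘ appF ∘ fanoutFn (polyFn X ∘ zOf) (List.cons false ∘ sndF)

/-- **The piece of stage `0`**: `prep n 0`, swap, copy, swap (round index unused). [folklore] -/
def piece0 : List Bool → List Bool :=
  appF ∘ fanoutFn (prep0F P ∘ zOf) (appF ∘ fanoutFn (swJF P (basePoly P)) (appF ∘ fanoutFn (copyJF P (C 2 * X + C 4)) (swJF P (basePoly P))))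

/-- **The piece of stage `j + 1`**: `prep n (j+1)`, swap, copy, swap. [folklore] -/
def pieceS : List Bool → List Bool :=
  appF ∘ fanoutFn (prepJF P) (appF ∘ fanoutFn (swJF P (basePoly P + BPoly P))
    (appF ∘ fanoutFn (copyJF P (C 2 * X + C 6 + P.pm)) (swJF P (basePoly P + BPoly P))))

/-- `1^{T n - 1}` from `z`. [folklore] -/
def predTF : List Bool → List Bool := dropFn ∘ fanoutFn (fun _ => [true]) (polyFn P.pT)

/-- **The tail piece**: the swap of block `T n - 1` (round index unused). [folklore] -/
def pieceT : List Bool → List Bool :=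
  SwapDesc.swapDescFn ∘ fanoutFn
    (addFn ∘ fanoutFn (lenBinF ∘ polyFn (basePoly P) ∘ zOf) (prodFn ∘ fanoutFn (lenBinF ∘ predTF P ∘ zOf) (lenBinF ∘ polyFn (BPoly P) ∘ zOf)))
    (polyFn (BPoly P) ∘ zOf)

variable {P}

/-- `zOf ∈ FP`. [folklore] -/
theorem zOf_mem_FP : zOf ∈ FP := comp_mem_FP fstF_mem_FP fstF_mem_FP

/-- `zOf` on a piece argument. [folklore] -/
@[simp] theorem zOf_apply (z r u : List Bool) : zOf (boolPair (boolPair z r) u) = z := by simp [zOf]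

/-- `swJF` computes the swap of block `j` (offset `off n + j B n = blk n j 0` when `off = base`). [folklore] -/
theorem swJF_apply (offPoly : Polynomial ℕ) (z r : List Bool) (j : ℕ) :
    swJF P offPoly (boolPair (boolPair z r) (ones j)) =
      SwapDesc.swapDescFn (boolPair (encodeNat (offPoly.eval z.length + j * B P z.length)) (ones (B P z.length))) := by
  simp [swJF, fanoutFn_apply, ones]

/-- `swJF ∈ FP`. [folklore] -/
theorem swJF_mem_FP (offPoly : Polynomial ℕ) : swJF P offPoly ∈ FP :=
  comp_mem_FP SwapDesc.swapDescFn_mem_FP (fanoutFn_mem_FP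
    (comp_mem_FP addFn_mem_FP (fanoutFn_mem_FP (comp_mem_FP lenBinF_mem_FP (comp_mem_FP (polyFn_mem_FP _) zOf_mem_FP))
      (comp_mem_FP prodFn_mem_FP (fanoutFn_mem_FP (comp_mem_FP lenBinF_mem_FP sndF_mem_FP)
        (comp_mem_FP lenBinF_mem_FP (comp_mem_FP (polyFn_mem_FP _) zOf_mem_FP))))))
    (comp_mem_FP (polyFn_mem_FP _) zOf_mem_FP))

/-- `copyJF` computes the body of the stage family's description at `1^{a n + 2j}`. [folklore] -/
theorem copyJF_apply (aPoly : Polynomial ℕ) (z r : List Bool) (j : ℕ) :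
    copyJF P aPoly (boolPair (boolPair z r) (ones j)) = (P.S.family.circ (aPoly.eval z.length + 2 * j)).encode := by
  simp only [copyJF, Function.comp_apply, fanoutFn_apply, zOf_apply, sndF_boolPair, CWrap.sndF_sndF_descFn, appF_boolPair,
    polyFn_apply, ones, List.length_replicate, eval_mul, eval_C, eval_X]
  rw [List.length_append, List.length_replicate, List.length_replicate]

/-- `copyJF ∈ FP`. [folklore] -/
theorem copyJF_mem_FP (aPoly : Polynomial ℕ) : copyJF P aPoly ∈ FP :=
  comp_mem_FP sndF_mem_FP (comp_mem_FP sndF_mem_FP (comp_mem_FP (QCircuitFamily.descFn_mem_FP_of_isUniform P.S.isUniform)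
    (comp_mem_FP appF_mem_FP (fanoutFn_mem_FP (comp_mem_FP (polyFn_mem_FP _) zOf_mem_FP) (comp_mem_FP (polyFn_mem_FP _) sndF_mem_FP)))))

/-- `prepJF` computes `prep n (j + 1)`. [folklore] -/
theorem prepJF_apply (z r : List Bool) (j : ℕ) :
    prepJF P (boolPair (boolPair z r) (ones j)) = (prep P z.length (j + 1)).flatMap opBits := by
  simp only [prepJF, Function.comp_apply, fanoutFn_apply, zOf_apply, sndF_boolPair, appF_boolPair, polyFn_apply, eval_X]
  exact prepSF_apply z.length j

/-- `prepJF ∈ FP`. [folklore] -/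
theorem prepJF_mem_FP : prepJF P ∈ FP :=
  comp_mem_FP prepSF_mem_FP (comp_mem_FP appF_mem_FP (fanoutFn_mem_FP (comp_mem_FP (polyFn_mem_FP _) zOf_mem_FP)
    (comp_mem_FP (cons_mem_FP false) sndF_mem_FP)))

/-- `ℓ n 0 = 2n + 4`. [folklore] -/
theorem ℓ_zero (n : ℕ) : ℓ P n 0 = 2 * n + 4 := by unfold ℓ yoff; simp

/-- `ℓ n (k+1) = 2n + 6 + m n + 2k`. [folklore] -/
theorem ℓ_succ (n k : ℕ) : ℓ P n (k + 1) = (C 2 * X + C 6 + P.pm).eval n + 2 * k := by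
  unfold ℓ yoff; simp [m]; ring

/-- **The stage-0 piece is the description of stage `0`** (round `0`, for `0 < T n`). [folklore] -/
theorem piece0_apply (z r : List Bool) (hT : 0 < T P z.length) :
    piece0 P (boolPair (boolPair z r) (ones 0)) = (stageGates P z.length 0).flatMap gateEnc := by
  have hsw : swJF P (basePoly P) (boolPair (boolPair z r) (ones 0)) = (progConj P z.length 0).flatMap opBits := by
    rw [swJF_apply, ← swapDescFn_blk (P := P) z.length 0, eval_basePoly]
    congr 3
  have hcp : copyJF P (C 2 * X + C 4) (boolPair (boolPair z r) (ones 0)) = (P.S.family.circ (ℓ P z.length 0)).encode := by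
    rw [copyJF_apply, ℓ_zero]
    have e : (C 2 * X + C 4 : Polynomial ℕ).eval z.length + 2 * 0 = 2 * z.length + 4 := by
      simp only [eval_add, eval_mul, eval_C, eval_X, Nat.mul_zero, Nat.add_zero]
    rw [e]
  rw [flatMap_gateEnc_stageGates hT, ← hsw, ← hcp, ← prep0F_apply z]
  simp [piece0, fanoutFn_apply]

/-- **The stage-`j+1` piece is the description of stage `j + 1`** (for `j + 1 < T n`). [folklore] -/
theorem pieceS_apply (z r : List Bool) {j : ℕ} (hj : j + 1 < T P z.length) :
    pieceS P (boolPair (boolPair z r) (ones j)) = (stageGates P z.length (j + 1)).flatMap gateEnc := by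
  have hsw : swJF P (basePoly P + BPoly P) (boolPair (boolPair z r) (ones j)) = (progConj P z.length (j + 1)).flatMap opBits := by
    rw [swJF_apply, ← swapDescFn_blk (P := P) z.length (j + 1), eval_add, eval_basePoly, eval_BPoly]
    congr 3
    unfold blk; ring
  have hcp : copyJF P (C 2 * X + C 6 + P.pm) (boolPair (boolPair z r) (ones j)) = (P.S.family.circ (ℓ P z.length (j + 1))).encode := by
    rw [copyJF_apply, ℓ_succ]
  rw [flatMap_gateEnc_stageGates hj, ← hsw, ← hcp, ← prepJF_apply z r j]
  simp [pieceS, fanoutFn_apply]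

/-- Value of `predTF`: `1^{T n - 1}`. [folklore] -/
theorem predTF_apply (z : List Bool) : predTF P z = ones (T P z.length - 1) := by
  simp [predTF, fanoutFn_apply, ones, List.drop_replicate, T]

/-- `predTF ∈ FP`. [folklore] -/
theorem predTF_mem_FP : predTF P ∈ FP := comp_mem_FP dropFn_mem_FP (fanoutFn_mem_FP (const_mem_FP _) (polyFn_mem_FP _))

/-- Value of the tail piece: the swap of block `T n - 1` at offset `blk n (T n - 1) 0`. [folklore] -/
theorem pieceT_eq (z r u : List Bool) :
    pieceT P (boolPair (boolPair z r) u) =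
      SwapDesc.swapDescFn (boolPair (encodeNat (blk P z.length (T P z.length - 1) 0)) (ones (B P z.length))) := by
  simp [pieceT, fanoutFn_apply, predTF_apply, ones, blk]

/-- **The tail piece is the description of the tail** (for `0 < T n`). [folklore] -/
theorem pieceT_apply (z r u : List Bool) (hT : 0 < T P z.length) :
    pieceT P (boolPair (boolPair z r) u) = (tailGates P z.length).flatMap gateEnc := by
  rw [pieceT_eq, swapDescFn_blk, tailGates, flatMap_gateEnc_conjGates (pred_lt z hT)]

/-- `pieceT ∈ FP`. [folklore] -/
theorem pieceT_mem_FP : pieceT P ∈ FP :=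
  comp_mem_FP SwapDesc.swapDescFn_mem_FP (fanoutFn_mem_FP
    (comp_mem_FP addFn_mem_FP (fanoutFn_mem_FP (comp_mem_FP lenBinF_mem_FP (comp_mem_FP (polyFn_mem_FP _) zOf_mem_FP))
      (comp_mem_FP prodFn_mem_FP (fanoutFn_mem_FP (comp_mem_FP lenBinF_mem_FP (comp_mem_FP predTF_mem_FP zOf_mem_FP))
        (comp_mem_FP lenBinF_mem_FP (comp_mem_FP (polyFn_mem_FP _) zOf_mem_FP))))))
    (comp_mem_FP (polyFn_mem_FP _) zOf_mem_FP))

/-- `piece0 ∈ FP`. [folklore] -/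
theorem piece0_mem_FP : piece0 P ∈ FP :=
  comp_mem_FP appF_mem_FP (fanoutFn_mem_FP (comp_mem_FP prep0F_mem_FP zOf_mem_FP) (comp_mem_FP appF_mem_FP
    (fanoutFn_mem_FP (swJF_mem_FP _) (comp_mem_FP appF_mem_FP (fanoutFn_mem_FP (copyJF_mem_FP _) (swJF_mem_FP _))))))

/-- `pieceS ∈ FP`. [folklore] -/
theorem pieceS_mem_FP : pieceS P ∈ FP :=
  comp_mem_FP appF_mem_FP (fanoutFn_mem_FP prepJF_mem_FP (comp_mem_FP appF_mem_FP
    (fanoutFn_mem_FP (swJF_mem_FP _) (comp_mem_FP appF_mem_FP (fanoutFn_mem_FP (copyJF_mem_FP _) (swJF_mem_FP _))))))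

end Pieces

/-! ### The folds -/

section Folds

variable (P) (ruler : Polynomial ℕ)

/-- The context of the folds: `⟨z, 1^{ruler |z|}⟩`. [folklore] -/
def ctxF : List Bool → List Bool := fanoutFn (fun z => z) (polyFn ruler)

/-- The round count `min (T n) 1` in binary (is there a stage at all?). [folklore] -/
def cnt1F : List Bool → List Bool := lenBinF ∘ takeFn ∘ fanoutFn (fun _ => [true]) (polyFn P.pT)

/-- The round count `T n - 1` in binary. [folklore] -/
def cntSF : List Bool → List Bool := lenBinF ∘ predTF P

/-- The initial record of a fold: `⟨ctx, ⟨cnt, ⟨1⁰, []⟩⟩⟩`. [folklore] -/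
def initF (cntF : List Bool → List Bool) : List Bool → List Bool :=
  fanoutFn (ctxF ruler) (fanoutFn cntF (fun _ => boolPair [] []))

/-- **A description fold**: the pieces `piece ⟨ctx, 1ʲ⟩`, `j < cnt`, concatenated.
[cite: AroraBarak2009, §1.3 (bounded loops)] -/
def foldF (piece cntF : List Bool → List Bool) : List Bool → List Bool :=
  sndPow 2 ∘ foldLoop appF (clipF 1 piece) X ∘ initF ruler cntF

variable {P ruler}

/-- Value of `ctxF`. [folklore] -/
theorem ctxF_apply (z : List Bool) : ctxF ruler z = boolPair z (ones (ruler.eval z.length)) := by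
  simp [ctxF, fanoutFn_apply]

/-- Value of `cnt1F`. [folklore] -/
theorem cnt1F_apply (z : List Bool) : cnt1F P z = encodeNat (min 1 (T P z.length)) := by
  simp [cnt1F, fanoutFn_apply, ones, List.take_replicate, T]

/-- Value of `cntSF`. [folklore] -/
theorem cntSF_apply (z : List Bool) : cntSF P z = encodeNat (T P z.length - 1) := by
  simp [cntSF, predTF_apply, ones]

/-- `cnt1F ∈ FP`. [folklore] -/
theorem cnt1F_mem_FP : cnt1F P ∈ FP :=
  comp_mem_FP lenBinF_mem_FP (comp_mem_FP takeFn_mem_FP (fanoutFn_mem_FP (const_mem_FP _) (polyFn_mem_FP _)))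

/-- `cntSF ∈ FP`. [folklore] -/
theorem cntSF_mem_FP : cntSF P ∈ FP := comp_mem_FP lenBinF_mem_FP predTF_mem_FP

/-- `foldF ∈ FP` for pieces and counters in `FP`. [folklore] -/
theorem foldF_mem_FP {piece cntF : List Bool → List Bool} (hp : piece ∈ FP) (hc : cntF ∈ FP) : foldF ruler piece cntF ∈ FP :=
  comp_mem_FP (sndPow_mem_FP 2) (comp_mem_FP (foldLoop_clipF_mem_FP 1 appF_mem_FP length_appF_le hp X)
    (fanoutFn_mem_FP (fanoutFn_mem_FP (PolyTimeComputable.id _) (polyFn_mem_FP _)) (fanoutFn_mem_FP hc (const_mem_FP _))))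

/-- **Semantics of a description fold**: with `R ≤ ruler |z|` rounds whose pieces fit under the
ruler, the fold is the concatenation of the pieces. [cite: AroraBarak2009, §1.3 (bounded loops)] -/
theorem foldF_apply {piece cntF : List Bool → List Bool} {z : List Bool} {R : ℕ} (hcnt : cntF z = encodeNat R)
    (hR : R ≤ ruler.eval z.length)
    (hpiece : ∀ j < R, (piece (boolPair (ctxF ruler z) (ones j))).length ≤ ruler.eval z.length) :
    foldF ruler piece cntF z = ccat (fun j => piece (boolPair (ctxF ruler z) (ones j))) R := by
  have hinit : initF ruler cntF z = boolPair (ctxF ruler z) (boolPair (encodeNat R) (boolPair (ones 0) [])) := by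
    simp [initF, fanoutFn_apply, hcnt, ones]
  have hlen : ruler.eval z.length ≤ (ctxF ruler z).length := by
    rw [ctxF_apply, length_boolPair]; simp [ones]
  have hrounds : R ≤ (X : Polynomial ℕ).eval (ctxF ruler z).length := by rw [eval_X]; exact hR.trans hlen
  have hpiece' : ∀ j, 0 ≤ j → j < 0 + R → (piece (boolPair (ctxF ruler z) (ones j))).length ≤ 1 * ((ctxF ruler z).length + 1) :=
    fun j _ hj => (hpiece j (by omega)).trans (by rw [one_mul]; exact hlen.trans (Nat.le_succ _))
  rw [foldF, Function.comp_apply, Function.comp_apply, hinit, foldLoop_apply appF (clipF 1 piece) hrounds 0 [],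
    sndPow_succ_boolPair, sndPow_succ_boolPair, sndPow_zero_boolPair, foldAcc_clipF hpiece', foldAcc_appF, List.nil_append]
  exact ccat_congr fun j _ => by rw [Nat.zero_add]

end Folds

/-! ### Size bounds for the pieces -/

section Bounds

/-- The swap pieces are small: `|swapDescFn ⟨bin (blk n k 0), 1^{B n}⟩| ≤ ps (2 W n + 2 + B n)` for
`k < T n`, given the size bound `ps` of `swapDescFn`. [folklore] -/
theorem length_swap_le {ps : Polynomial ℕ} (hps : ∀ v, (SwapDesc.swapDescFn v).length ≤ ps.eval v.length) {n k : ℕ}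
    (hk : k < T P n) :
    (SwapDesc.swapDescFn (boolPair (encodeNat (blk P n k 0)) (ones (B P n)))).length ≤ ps.eval (2 * W P n + 2 + B P n) := by
  refine (hps _).trans (TM2Iter.eval_mono ps ?_)
  rw [length_boolPair]
  have hb : (encodeNat (blk P n k 0)).length ≤ W P n :=
    (Complexity.length_encodeNat_le_self _).trans (blk_lt_W hk (B_pos n)).le
  simp [ones]; omega

/-- The copies are small: `|encode (S.circ (ℓ n k))| ≤ pd (ℓmax n)` for `k < T n`, given the size bound
`pd` of `S.descFn`. [folklore] -/
theorem length_copy_le {pd : Polynomial ℕ} (hpd : ∀ u, (P.S.family.descFn u).length ≤ pd.eval u.length) {n k : ℕ}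
    (hk : k < T P n) : (P.S.family.circ (ℓ P n k)).encode.length ≤ pd.eval (ℓmax P n) := by
  have h := hpd (ones (ℓ P n k))
  rw [QCircuitFamily.descFn_eq] at h
  rw [show (ones (ℓ P n k)).length = ℓ P n k by simp [ones]] at h
  rw [length_boolPair, length_boolPair] at h
  exact le_trans (by omega) (TM2Iter.eval_mono pd (ℓ_le_ℓmax hk))

end Bounds

/-! ### The description and the assembly -/

section Assembly

variable (P) (pp0 ppS ps pd : Polynomial ℕ)

/-- The ruler polynomial: room for the rounds and for every piece. [folklore] -/
def rulerPoly : Polynomial ℕ :=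
  P.pT + pp0 + ppS.comp (X + P.pT) + C 2 * ps.comp (C 2 * WPoly P + C 2 + BPoly P) + pd.comp (ℓmaxPoly P) + 1

/-- **The body of the description**: stage `0`, the stages `k + 1`, the tail. [folklore] -/
def descBody : List Bool → List Bool := fun z =>
  foldF (rulerPoly P pp0 ppS ps pd) (piece0 P) (cnt1F P) z ++
    (foldF (rulerPoly P pp0 ppS ps pd) (pieceS P) (cntSF P) z ++ foldF (rulerPoly P pp0 ppS ps pd) (pieceT P) (cnt1F P) z)

/-- The ancilla count in unary: `1^{W n}` with the first `n` symbols dropped. [folklore] -/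
def ancF : List Bool → List Bool := dropFn ∘ fanoutFn (fun z => z) (polyFn (WPoly P))

variable {P pp0 ppS ps pd}

/-- Value of `ancF`. [folklore] -/
theorem ancF_apply (z : List Bool) : ancF P z = unaryEncodeNat (anc P z.length) := by
  simp only [ancF, Function.comp_apply, fanoutFn_apply, dropFn_boolPair, polyFn_apply, eval_WPoly, ones, List.drop_replicate, anc]
  exact (RevDesc.unaryEncodeNat_eq_replicate _).symm

/-- `ancF ∈ FP`. [folklore] -/
theorem ancF_mem_FP : ancF P ∈ FP := comp_mem_FP dropFn_mem_FP (fanoutFn_mem_FP (PolyTimeComputable.id _) (polyFn_mem_FP _))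

/-- `descBody ∈ FP`. [folklore] -/
theorem descBody_mem_FP : descBody P pp0 ppS ps pd ∈ FP :=
  append_mem_FP (foldF_mem_FP piece0_mem_FP cnt1F_mem_FP)
    (append_mem_FP (foldF_mem_FP pieceS_mem_FP cntSF_mem_FP) (foldF_mem_FP pieceT_mem_FP cnt1F_mem_FP))

/-- Value of the ruler. [folklore] -/
theorem eval_rulerPoly (n : ℕ) : (rulerPoly P pp0 ppS ps pd).eval n =
    T P n + pp0.eval n + ppS.eval (n + T P n) + 2 * ps.eval (2 * W P n + 2 + B P n) + pd.eval (ℓmax P n) + 1 := by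
  simp [rulerPoly, Polynomial.eval_comp, T]

/-- **The body of the description is the encoding of the circuit**, provided the four size bounds
hold: `pp0` for `prep0F`, `ppS` for `prepSF`, `ps` for `swapDescFn`, `pd` for `S.descFn`. [folklore] -/
theorem descBody_apply (hpp0 : ∀ u, (prep0F P u).length ≤ pp0.eval u.length) (hppS : ∀ u, (prepSF P u).length ≤ ppS.eval u.length)
    (hps : ∀ v, (SwapDesc.swapDescFn v).length ≤ ps.eval v.length) (hpd : ∀ u, (P.S.family.descFn u).length ≤ pd.eval u.length)
    (z : List Bool) : descBody P pp0 ppS ps pd z = (circ P z.length).encode := by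
  set n := z.length with hn
  set rul := rulerPoly P pp0 ppS ps pd with hrul
  have hr : rul.eval n = T P n + pp0.eval n + ppS.eval (n + T P n) + 2 * ps.eval (2 * W P n + 2 + B P n) + pd.eval (ℓmax P n) + 1 :=
    eval_rulerPoly n
  -- the stage pieces fit under the ruler
  have hfit0 : 0 < T P n → (piece0 P (boolPair (ctxF rul z) (ones 0))).length ≤ rul.eval n := by
    intro hT
    rw [ctxF_apply, piece0_apply z _ (by rw [← hn]; exact hT), flatMap_gateEnc_stageGates (by rw [← hn]; exact hT), ← hn]
    simp only [List.length_append]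
    have h1 : ((prep P n 0).flatMap opBits).length ≤ pp0.eval n := by rw [← prep0F_apply z, hn]; exact hpp0 z
    have h2 := length_swap_le hps hT
    rw [swapDescFn_blk] at h2
    have h3 := length_copy_le hpd hT
    omega
  have hfitS : ∀ j, j + 1 < T P n → (pieceS P (boolPair (ctxF rul z) (ones j))).length ≤ rul.eval n := by
    intro j hj
    rw [ctxF_apply, pieceS_apply z _ (by rw [← hn]; exact hj), flatMap_gateEnc_stageGates (by rw [← hn]; exact hj), ← hn]
    simp only [List.length_append]
    have h1 : ((prep P n (j + 1)).flatMap opBits).length ≤ ppS.eval (n + T P n) := by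
      rw [← prepSF_apply n j]
      refine (hppS _).trans (TM2Iter.eval_mono ppS ?_)
      simp [ones]; omega
    have h2 := length_swap_le hps hj
    rw [swapDescFn_blk] at h2
    have h3 := length_copy_le hpd hj
    omega
  have hfitT : 0 < T P n → (pieceT P (boolPair (ctxF rul z) (ones 0))).length ≤ rul.eval n := by
    intro hT
    rw [ctxF_apply, pieceT_eq, ← hn]
    have h2 := length_swap_le hps (pred_lt' hT)
    omega
  -- the three folds
  have e0 : foldF rul (piece0 P) (cnt1F P) z = ccat (fun j => piece0 P (boolPair (ctxF rul z) (ones j))) (min 1 (T P n)) :=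
    foldF_apply (cnt1F_apply z) (by rw [hr]; omega) fun j hj => by
      have hj0 : j = 0 := by omega
      subst hj0
      exact hfit0 (by omega)
  have eS : foldF rul (pieceS P) (cntSF P) z = ccat (fun j => pieceS P (boolPair (ctxF rul z) (ones j))) (T P n - 1) :=
    foldF_apply (cntSF_apply z) (by rw [hr]; omega) fun j hj => hfitS j (by omega)
  have eT : foldF rul (pieceT P) (cnt1F P) z = ccat (fun j => pieceT P (boolPair (ctxF rul z) (ones j))) (min 1 (T P n)) :=
    foldF_apply (cnt1F_apply z) (by rw [hr]; omega) fun j hj => by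
      have hj0 : j = 0 := by omega
      subst hj0
      exact hfitT (by omega)
  rw [descBody, ← hrul, e0, eS, eT]
  -- the encoding of the circuit, stage by stage
  have henc : (circ P n).encode = (bodyGates P n).flatMap gateEnc ++ (tailGates P n).flatMap gateEnc := by
    unfold circ; rw [encode_eq_flatMap, List.flatMap_append]
  rw [henc, bodyGates, List.flatMap_assoc]
  rcases Nat.eq_zero_or_pos (T P n) with hT | hT
  · have ht : tailGates P n = [] := by rw [tailGates, conjGates, dif_neg (by omega)]
    rw [hT, ht, List.range_zero, List.flatMap_nil, List.flatMap_nil, show min 1 0 = 0 from rfl, show 0 - 1 = 0 from rfl, ccat_zero,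
      ccat_zero, ccat_zero, List.nil_append, List.nil_append]
  · obtain ⟨R, hR⟩ : ∃ R, T P n = R + 1 := ⟨T P n - 1, by omega⟩
    have e1 : ccat (fun j => piece0 P (boolPair (ctxF rul z) (ones j))) (min 1 (T P n)) = (stageGates P n 0).flatMap gateEnc := by
      rw [hR, show min 1 (R + 1) = 0 + 1 by omega, ccat_succ, ccat_zero, List.nil_append, ctxF_apply, piece0_apply z _ (by rw [← hn]; omega), ← hn]
    have e2 : ccat (fun j => pieceT P (boolPair (ctxF rul z) (ones j))) (min 1 (T P n)) = (tailGates P n).flatMap gateEnc := by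
      rw [hR, show min 1 (R + 1) = 0 + 1 by omega, ccat_succ, ccat_zero, List.nil_append, ctxF_apply, pieceT_apply z _ _ (by rw [← hn]; omega), ← hn]
    have e3 : ccat (fun j => pieceS P (boolPair (ctxF rul z) (ones j))) (T P n - 1) =
        ccat (fun j => (stageGates P n (j + 1)).flatMap gateEnc) R := by
      rw [hR, Nat.add_sub_cancel, ctxF_apply]
      exact ccat_congr fun j hj => by rw [pieceS_apply z _ (by rw [← hn]; omega), ← hn]
    have e4 : ((List.range R).map Nat.succ).flatMap (fun k => (stageGates P n k).flatMap gateEnc) =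
        ccat (fun j => (stageGates P n (j + 1)).flatMap gateEnc) R := by
      rw [List.flatMap_map, CWrap.flatMap_range_eq_ccat]
    rw [e1, e2, e3, hR, List.range_succ_eq_map, List.flatMap_cons, e4, List.append_assoc]

variable (P)

/-- **The chain family is polynomial-time uniform.** [cite: AroraBarak2009, §6.2 Def. 6.12 and Remark 6.7 (descriptions printed in polynomial time)] -/
theorem family_isUniform : (family P).IsUniform := by
  obtain ⟨pp0, hpp0⟩ := exists_poly_length_le_of_mem_FP (prep0F_mem_FP (P := P))
  obtain ⟨ppS, hppS⟩ := exists_poly_length_le_of_mem_FP (prepSF_mem_FP (P := P))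
  obtain ⟨ps, hps⟩ := exists_poly_length_le_of_mem_FP SwapDesc.swapDescFn_mem_FP
  obtain ⟨pd, hpd⟩ := exists_poly_length_le_of_mem_FP (QCircuitFamily.descFn_mem_FP_of_isUniform P.S.isUniform)
  refine QCircuitFamily.isUniform_of_descFn_mem_FP ?_
  have h := fanoutFn_mem_FP lenBinF_mem_FP (fanoutFn_mem_FP (ancF_mem_FP (P := P)) (descBody_mem_FP (P := P) (pp0 := pp0) (ppS := ppS) (ps := ps) (pd := pd)))
  have e : (family P).descFn = fanoutFn lenBinF (fanoutFn (ancF P) (descBody P pp0 ppS ps pd)) := by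
    funext z
    rw [fanoutFn_apply, fanoutFn_apply, lenBinF_apply, ancF_apply, descBody_apply hpp0 hppS hps hpd, QCircuitFamily.descFn_eq]
    rfl
  rw [e]
  exact h

/-- **The chain family, bundled**: a poly-time uniform oracle-free Clifford+T family.
[cite: BernsteinVazirani1997, §8.2 (subroutine calls inside quantum machines)] -/
def chainFamily : UniformQCircuitFamily := ⟨family P, family_isOracleFree P, family_isUniform P⟩

/-- The kernel of the bundled family is the kernel of `family P`. [folklore] -/
@[simp] theorem kernel_chainFamily (x : List Bool) : (chainFamily P).kernel x = (family P).kernel 0 x := rfl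

end Assembly

/-! ### `hLoop` -/

/-- **Iterated composition of a uniform family** — hypothesis `hLoop` of
`Literature.Computability.Cryptography.Regev2009.thm_3_1_machine_of_stages` in the generic form of
`StageChains.chainLaw`: for every poly-time uniform oracle-free Clifford+T family `S` and polynomials `T`,
`m`, there is a uniform family `D` (namely `chainFamily ⟨S, pS, _, T, m⟩` with `pS` the size polynomial
of `S`) such that for every input `x` and event `E`,
`(chainLaw 0 S.family (m |x|) x (T |x|))(E) ≤ Pr[some y ∈ E is a prefix of D's measured register on x]`.
[cite: BernsteinVazirani1997, §8.2 (classical control and subroutine calls inside quantum machines)] -/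
theorem exists_chainFamily (S : UniformQCircuitFamily) (T m : Polynomial ℕ) :
    ∃ D : UniformQCircuitFamily, ∀ (x : List Bool) (E : Set (List Bool)),
      (chainLaw 0 S.family (m.eval x.length) x (T.eval x.length)).toOuterMeasure E ≤
        (D.kernel x).toOuterMeasure {z | ∃ y ∈ E, y <+: z} := by
  obtain ⟨pS, hpS⟩ := QCircuitFamily.IsUniform.isPolySize_holds S.isUniform
  exact ⟨chainFamily ⟨S, pS, fun n => (hpS n).2, T, m⟩, fun x E => chainLaw_toOuterMeasure_le _ x E⟩


end Uniform

end ChainCompose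

end Literature.Computability.QuantumComplexity

end
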